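import Mathlib
import Summits.ValiantsHypothesis.ValiantsHypothesis.Theorems.FifoMatchingNNDivisionHardNarrowBandLocal
import HarnessLib

/-!
# Route FifoMatching — crux `NNDivisionHard` (stmt-ValiantsHypothesis-21181): INTERIOR CERTIFICATES HAVE MANY ARC LENGTHS

The quotable consequence of `…NarrowBandLocal.lean`.  The narrow bands `B°(u) = [16u⁴ + 4u³ + 1, 16u⁴ + 8u³ − 1]` of the
admissible parameters `u` (`T(u) = 192u⁵ + 176u⁴ + 29u³ + 24u + 4 ≤ n`, `20 n (log₂ n + 1) ≤ u⁶`) are pairwise DISJOINT, and an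
INTERIOR cofactor (every variable `x_(i,j)` with `Λ ≤ i`, `j + Λ < 2n` for a margin `Λ` with `n⁴ ≤ Λ⁵`, i.e. `Λ ≥ n^{4/5}`, which
dominates every padding length `8u⁴ + 3u³`) must have an arc length in `B°(u)` for every admissible `u`.  Hence, by pigeonhole:

* `padding_le_of_margin` — `8u⁴ + 3u³ ≤ Λ` for admissible `u` and `n⁴ ≤ Λ⁵`;
* `narrowBand_disjoint` — `u < u' ⇒ 16u⁴ + 8u³ < 16u'⁴ + 4u'³ + 2` (the narrow bands are disjoint);
* ★★ `fewLengths_not_certificate_qp` — **for every `c`, eventually in `n`: an interior cofactor `h ≠ 0` whose set of arc lengths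
  `{j − i : x_(i,j) ∈ vars h}` has FEWER elements than there are admissible parameters `u` is not a certificate:
  `2^((log₂ n + c)^c) < L₊(NN_n · h) + L₊(h)`.**  The number of admissible `u` is `#{u : T(u) ≤ n, 20 n (log₂ n + 1) ≤ u⁶}`, of
  order `(n/192)^{1/5} − (20 n (log₂ n + 1))^{1/6} = Θ(n^{1/5})`.

HONEST FRAMING: a structural constraint on certificates for ONE candidate family; stmt-21181 stays OPEN; nothing here bears on
`NNNotVP` or on VP ≠ VNP (NOT proved).  No definitions, no named facts.
References: Hrubeš–Yehudayoff 2021 §6 Problem 2 [HrubesYehudayoff2021]; Bürgisser 2000 Rem. 2.7 [Burgisser2000].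
-/

noncomputable section

-- Sub = Summit single-conjunct layout: the duplicated namespace component is mandated by the tree.
set_option linter.dupNamespace false
set_option autoImplicit false

namespace Summit.ValiantsHypothesis.ValiantsHypothesis.Theorems.FifoMatching.NNDivisionHard.FewLengths

open Finset MvPolynomial Literature.Computability.AlgebraicComplexity
open Summit.ValiantsHypothesis.ValiantsHypothesis.Theorems.FifoMatching.NNDivisionHard.NarrowBandLocal
  (narrowAvoiding_not_certificate_qp)
open scoped NNReal BigOperators

variable {n : ℕ}

/-- The padding length of an admissible parameter is below any margin `Λ` with `n⁴ ≤ Λ⁵`: `8u⁴ + 3u³ ≤ Λ`. [folklore] -/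
theorem padding_le_of_margin {u Λ : ℕ} (hT : 192 * u ^ 5 + 176 * u ^ 4 + 29 * u ^ 3 + 24 * u + 4 ≤ n) (hΛ : n ^ 4 ≤ Λ ^ 5) :
    8 * u ^ 4 + 3 * u ^ 3 ≤ Λ := by
  have h34 : u ^ 3 ≤ u ^ 4 := by
    rcases Nat.eq_zero_or_pos u with h0 | h0
    · subst h0; simp
    · exact Nat.pow_le_pow_right h0 (by norm_num)
  have h1 : 8 * u ^ 4 + 3 * u ^ 3 ≤ 11 * u ^ 4 := by omega
  have h2 : 192 * u ^ 5 ≤ n := by omega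
  have h3 : (11 * u ^ 4) ^ 5 ≤ (192 * u ^ 5) ^ 4 := by
    rw [mul_pow, mul_pow, ← pow_mul, ← pow_mul]
    exact Nat.mul_le_mul_right _ (by norm_num)
  have h4 : (192 * u ^ 5) ^ 4 ≤ n ^ 4 := Nat.pow_le_pow_left h2 4
  have h5 : (8 * u ^ 4 + 3 * u ^ 3) ^ 5 ≤ Λ ^ 5 :=
    (Nat.pow_le_pow_left h1 5).trans (h3.trans (h4.trans hΛ))
  exact (Nat.pow_le_pow_iff_left (by norm_num)).1 h5

/-- The narrow bands are disjoint: `u < u' ⇒ 16u⁴ + 8u³ < 16u'⁴ + 4u'³ + 2`. [folklore] -/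
theorem narrowBand_disjoint {u u' : ℕ} (h : u < u') : 16 * u ^ 4 + 8 * u ^ 3 < 16 * u' ^ 4 + 4 * u' ^ 3 + 2 := by
  have h1 : (u + 1) ^ 4 ≤ u' ^ 4 := Nat.pow_le_pow_left h 4
  have e : (u + 1) ^ 4 = u ^ 4 + 4 * u ^ 3 + 6 * u ^ 2 + 4 * u + 1 := by ring
  omega

/-- ★★ **INTERIOR CERTIFICATES HAVE MANY DISTINCT ARC LENGTHS.**  For every `c`, eventually in `n`: let `Λ` be a margin with
`n⁴ ≤ Λ⁵` and `h ≠ 0` an interior cofactor (`Λ ≤ i` and `j + Λ < 2n` for every variable `x_(i,j)` of `h`).  If the number of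
distinct arc lengths `j − i` of the variables of `h` is smaller than the number of admissible parameters
`#{u ≤ n : T(u) ≤ n, 20 n (log₂ n + 1) ≤ u⁶}`, then `2^((log₂ n + c)^c) < L₊(NN_n · h) + L₊(h)`.
[cite: HrubesYehudayoff2021, §6 Problem 2] [cite: Burgisser2000, Rem. 2.7] -/
theorem fewLengths_not_certificate_qp (c : ℕ) : ∃ n₀ : ℕ, ∀ n : ℕ, n₀ ≤ n → ∀ Λ : ℕ, n ^ 4 ≤ Λ ^ 5 →
    ∀ h : MvPolynomial (Fin (2 * n) × Fin (2 * n)) ℝ≥0, h ≠ 0 →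
      (∀ e ∈ h.vars, Λ ≤ (e.1 : ℕ) ∧ (e.2 : ℕ) + Λ < 2 * n) →
      (h.vars.image fun e => (e.2 : ℕ) - (e.1 : ℕ)).card <
        ((Finset.range (n + 1)).filter fun u =>
          192 * u ^ 5 + 176 * u ^ 4 + 29 * u ^ 3 + 24 * u + 4 ≤ n ∧ 20 * n * (Nat.log 2 n + 1) ≤ u ^ 6).card →
      2 ^ ((Nat.log 2 n + c) ^ c) < complexity (nestFreeMatchingPoly n ℝ≥0 * h) + complexity h := by
  classical
  obtain ⟨n₀, hn₀⟩ := narrowAvoiding_not_certificate_qp c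
  refine ⟨n₀, fun n hn Λ hΛ h hh hint hfew => ?_⟩
  set U := (Finset.range (n + 1)).filter fun u =>
    192 * u ^ 5 + 176 * u ^ 4 + 29 * u ^ 3 + 24 * u + 4 ≤ n ∧ 20 * n * (Nat.log 2 n + 1) ≤ u ^ 6 with hU
  set Lset := h.vars.image fun e => (e.2 : ℕ) - (e.1 : ℕ) with hLset
  -- some admissible `u` has no arc length of `h` in its narrow band
  have hmiss : ∃ u ∈ U, ∀ e ∈ h.vars,
      ¬ (16 * u ^ 4 + 4 * u ^ 3 + 1 ≤ (e.2 : ℕ) - (e.1 : ℕ) ∧ (e.2 : ℕ) - (e.1 : ℕ) + 1 ≤ 16 * u ^ 4 + 8 * u ^ 3) := by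
    by_contra hall
    push Not at hall
    -- choose, for each admissible `u`, a length in its band: an injection `U → Lset`
    have hch : ∀ u ∈ U, ∃ ℓ ∈ Lset, 16 * u ^ 4 + 4 * u ^ 3 + 1 ≤ ℓ ∧ ℓ + 1 ≤ 16 * u ^ 4 + 8 * u ^ 3 := by
      intro u hu
      obtain ⟨e, he, h1, h2⟩ := hall u hu
      exact ⟨(e.2 : ℕ) - (e.1 : ℕ), Finset.mem_image.2 ⟨e, he, rfl⟩, h1, h2⟩
    choose! g hg using hch
    have hinj : Set.InjOn g U := by
      intro u hu u' hu' hgg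
      obtain ⟨-, h1, h2⟩ := hg u hu
      obtain ⟨-, h1', h2'⟩ := hg u' hu'
      rw [hgg] at h1 h2
      by_contra hne
      rcases lt_or_gt_of_ne hne with hlt | hlt
      · have := narrowBand_disjoint hlt
        omega
      · have := narrowBand_disjoint hlt
        omega
    have hle : U.card ≤ Lset.card := Finset.card_le_card_of_injOn g (fun u hu => (hg u hu).1) hinj
    omega
  obtain ⟨u, hu, hno⟩ := hmiss
  rw [hU, Finset.mem_filter] at hu
  obtain ⟨-, hT, hlog⟩ := hu
  have hpad := padding_le_of_margin hT hΛ
  refine hn₀ n hn u hT hlog h hh fun e he hQ => ?_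
  obtain ⟨hmid, hlo, hhi⟩ := hQ
  obtain ⟨hi1, hi2⟩ := hint e he
  have h3 := hmid (le_trans hpad hi1) (by omega)
  exact hno e he ⟨by omega, by omega⟩

end Summit.ValiantsHypothesis.ValiantsHypothesis.Theorems.FifoMatching.NNDivisionHard.FewLengths

end
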